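import Mathlib.Analysis.Analytic.IsolatedZeros
import Mathlib.Analysis.Calculus.InverseFunctionTheorem.Deriv
import Mathlib.Analysis.Complex.CauchyIntegral
import Mathlib.RingTheory.RootsOfUnity.Complex
import Mathlib.FieldTheory.Separable

/-!
# Local fibre count of a holomorphic function from its local normal form

Crux `WitnessCharge` (statement item `stmt-SmoothPoincare4-7824`), line `Sketch`,
stub `helper_localFibreCount`.

If a function `f : ℂ → ℂ` has the local normal form `f = f z₀ + φ ^ n` near `z₀`, where `φ` is a
local holomorphic coordinate at `z₀` (`φ` analytic at `z₀`, `φ z₀ = 0`, `deriv φ z₀ ≠ 0`) and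
`0 < n`, then inside any prescribed neighbourhood `W` of `z₀` there is an open neighbourhood `V`
of `z₀` such that

* the only solution of `f z = f z₀` in `V` is `z = z₀`;
* every value `c ≠ f z₀` with `‖c - f z₀‖ < δ` (for a suitable `δ > 0`) has exactly `n` preimages
  under `f` in `V`, and `deriv f ≠ 0` at each of them.

This is the local mapping degree statement (Conway, *Functions of one complex variable*, VII.4;
Rudin, *Real and complex analysis*, 10.32), proved here from the one-dimensional inverse function
theorem (`HasStrictDerivAt.eventually_left_inverse`, `HasStrictDerivAt.map_nhds_eq`) and the
count of complex `n`-th roots (`IsPrimitiveRoot.card_nthRoots`, `IsPrimitiveRoot.nthRoots_nodup`).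

## Main results

* `helper_localFibreCount_ncard_nthRoots`: for `a ≠ 0` and `0 < n` the set `{w | w ^ n = a}` of
  complex `n`-th roots of `a` has exactly `n` elements.
* `helper_localFibreCount`: the local fibre count described above.
-/

noncomputable section

set_option linter.dupNamespace false

open Set Filter Topology

namespace Summit.SmoothPoincare4.SmoothPoincare4.Theorems.WitnessCharge.PencilIncompleteness

/-- **Complex `n`-th roots.** For `a ≠ 0` and `0 < n`, the set of complex solutions of
`w ^ n = a` has exactly `n` elements: the multiset `Polynomial.nthRoots n a` has `n` elements
(ℂ contains a primitive `n`-th root of unity and an `n`-th root of `a`) and no duplicates. -/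
theorem helper_localFibreCount_ncard_nthRoots {n : ℕ} (hn : 0 < n) {a : ℂ} (ha : a ≠ 0) :
    {w : ℂ | w ^ n = a}.ncard = n := by
  classical
  have hζ := Complex.isPrimitiveRoot_exp n hn.ne'
  have hset : {w : ℂ | w ^ n = a} = ↑(Polynomial.nthRootsFinset n a) := by
    ext w
    simp only [mem_setOf_eq, Finset.mem_coe, Polynomial.mem_nthRootsFinset hn]
  rw [hset, ncard_coe_finset, Polynomial.nthRootsFinset_def,
    Multiset.toFinset_card_of_nodup (hζ.nthRoots_nodup ha), hζ.card_nthRoots,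
    if_pos ⟨_, Complex.cpow_nat_inv_pow a hn.ne'⟩]

/-- **Local fibre count from the normal form.** Let `f φ : ℂ → ℂ`, `z₀ : ℂ` and `0 < n` be such
that `φ` is analytic at `z₀` with `φ z₀ = 0` and `deriv φ z₀ ≠ 0`, and `f z = f z₀ + (φ z) ^ n`
for all `z` near `z₀`. Then every neighbourhood `W` of `z₀` contains an open neighbourhood `V` of
`z₀` on which `f` takes the value `f z₀` only at `z₀`, together with a radius `δ > 0` such that
every `c ≠ f z₀` with `‖c - f z₀‖ < δ` has exactly `n` preimages under `f` in `V`, at each of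
which `deriv f` does not vanish.

Proof: by the inverse function theorem `φ` is injective on a neighbourhood of `z₀` and maps
neighbourhoods of `z₀` onto neighbourhoods of `0`; shrink to an open `N ⊆ W` on which moreover the
normal form holds, `φ` is analytic and `deriv φ ≠ 0`, pick `ρ > 0` with `ball 0 ρ ⊆ φ '' N`, and
put `V := N ∩ φ ⁻¹' (ball 0 ρ)`, `δ := ρ ^ n`. Then `φ` maps `{z ∈ V | f z = c}` bijectively onto
the set of `n`-th roots of `c - f z₀`, which has `n` elements, and
`deriv f z = n * φ z ^ (n - 1) * deriv φ z ≠ 0` there. -/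
theorem helper_localFibreCount :
    ∀ (f φ : ℂ → ℂ) (z₀ : ℂ) (n : ℕ), 0 < n → AnalyticAt ℂ φ z₀ → φ z₀ = 0 →
      deriv φ z₀ ≠ 0 → (∀ᶠ z in 𝓝 z₀, f z = f z₀ + (φ z) ^ n) →
      ∀ W ∈ 𝓝 z₀, ∃ V ∈ 𝓝 z₀, IsOpen V ∧ V ⊆ W ∧ (∀ z ∈ V, f z = f z₀ → z = z₀) ∧
        ∃ δ : ℝ, 0 < δ ∧ ∀ c : ℂ, c ≠ f z₀ → ‖c - f z₀‖ < δ →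
          {z ∈ V | f z = c}.ncard = n ∧ (∀ z ∈ V, f z = c → deriv f z ≠ 0) := by
  intro f φ z₀ n hn hφ hφ0 hφ' hnf W hW
  -- strict differentiability of the coordinate `φ` at `z₀`
  have hstrict : HasStrictDerivAt φ (deriv φ z₀) z₀ := hφ.hasStrictDerivAt
  -- inverse function theorem: `φ` has a left inverse near `z₀`
  obtain ⟨g, hg⟩ : ∃ g : ℂ → ℂ, ∀ᶠ z in 𝓝 z₀, g (φ z) = z :=
    ⟨_, hstrict.eventually_left_inverse hφ'⟩
  -- `φ` is analytic near `z₀`, and `deriv φ` does not vanish near `z₀`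
  have han : ∀ᶠ z in 𝓝 z₀, AnalyticAt ℂ φ z := hφ.eventually_analyticAt
  have hder : ∀ᶠ z in 𝓝 z₀, deriv φ z ≠ 0 := hφ.deriv.continuousAt.eventually_ne hφ'
  -- an open neighbourhood `N ⊆ W` of `z₀` on which all of the above hold
  have hall : ∀ᶠ z in 𝓝 z₀, z ∈ W ∧ f z = f z₀ + φ z ^ n ∧ g (φ z) = z ∧
      AnalyticAt ℂ φ z ∧ deriv φ z ≠ 0 := by
    filter_upwards [hW, hnf, hg, han, hder] with z h₁ h₂ h₃ h₄ h₅
    exact ⟨h₁, h₂, h₃, h₄, h₅⟩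
  obtain ⟨N, hN, hNopen, hz₀N⟩ := eventually_nhds_iff.mp hall
  have hNW : N ⊆ W := fun z hz => (hN z hz).1
  have hNf : ∀ z ∈ N, f z = f z₀ + φ z ^ n := fun z hz => (hN z hz).2.1
  have hNan : ∀ z ∈ N, AnalyticAt ℂ φ z := fun z hz => (hN z hz).2.2.2.1
  have hNder : ∀ z ∈ N, deriv φ z ≠ 0 := fun z hz => (hN z hz).2.2.2.2
  have hinjN : InjOn φ N := by
    intro x hx y hy hxy
    rw [← (hN x hx).2.2.1, ← (hN y hy).2.2.1, hxy]
  -- `φ '' N` is a neighbourhood of `0 = φ z₀`; choose a ball inside it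
  have himage : φ '' N ∈ 𝓝 (0 : ℂ) := by
    have h := image_mem_map (m := φ) (hNopen.mem_nhds hz₀N)
    rw [hstrict.map_nhds_eq hφ', hφ0] at h
    exact h
  obtain ⟨ρ, hρ, hball⟩ := Metric.mem_nhds_iff.mp himage
  -- the neighbourhood `V := N ∩ φ ⁻¹' ball 0 ρ`
  have hVopen : IsOpen (N ∩ φ ⁻¹' Metric.ball 0 ρ) :=
    ContinuousOn.isOpen_inter_preimage
      (fun z hz => (hNan z hz).continuousAt.continuousWithinAt) hNopen Metric.isOpen_ball
  have hz₀V : z₀ ∈ N ∩ φ ⁻¹' Metric.ball 0 ρ :=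
    ⟨hz₀N, mem_preimage.mpr (by rw [hφ0]; exact Metric.mem_ball_self hρ)⟩
  refine ⟨N ∩ φ ⁻¹' Metric.ball 0 ρ, hVopen.mem_nhds hz₀V, hVopen, fun z hz => hNW hz.1, ?_,
    ρ ^ n, pow_pos hρ n, ?_⟩
  · -- the fibre of `f z₀` inside `V` is `{z₀}`
    intro z hz hfz
    have h1 : f z₀ + φ z ^ n = f z₀ := by rw [← hNf z hz.1, hfz]
    have h2 : φ z = φ z₀ := by
      rw [hφ0]
      exact (pow_eq_zero_iff hn.ne').mp (add_eq_left.mp h1)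
    exact hinjN hz.1 hz₀N h2
  · intro c hc hcδ
    have ha : c - f z₀ ≠ 0 := sub_ne_zero.mpr hc
    -- on `N`, the fibre of `c` is described by `φ`
    have hfibre : ∀ z ∈ N, (f z = c ↔ φ z ^ n = c - f z₀) := by
      intro z hz
      rw [hNf z hz]
      exact eq_sub_iff_add_eq'.symm
    -- `φ` maps the fibre of `c` in `V` bijectively onto the set of `n`-th roots of `c - f z₀`
    have hbij : BijOn φ {z ∈ N ∩ φ ⁻¹' Metric.ball 0 ρ | f z = c}
        {w : ℂ | w ^ n = c - f z₀} := by
      refine ⟨fun z hz => (hfibre z hz.1.1).mp hz.2, hinjN.mono fun z hz => hz.1.1, ?_⟩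
      intro w hw
      have hwρ : w ∈ Metric.ball (0 : ℂ) ρ := by
        rw [Metric.mem_ball, dist_zero_right]
        refine lt_of_pow_lt_pow_left₀ n hρ.le ?_
        rw [← norm_pow, show w ^ n = c - f z₀ from hw]
        exact hcδ
      obtain ⟨z, hzN, hzw⟩ := hball hwρ
      refine ⟨z, ⟨⟨hzN, mem_preimage.mpr ?_⟩, ?_⟩, hzw⟩
      · rw [hzw]
        exact hwρ
      · rw [hfibre z hzN, hzw]
        exact hw
    refine ⟨?_, ?_⟩
    · rw [hbij.ncard_eq]
      exact helper_localFibreCount_ncard_nthRoots hn ha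
    · intro z hz hfz
      have hzN : z ∈ N := hz.1
      have hφz : φ z ≠ 0 := by
        intro h0
        have h := (hfibre z hzN).mp hfz
        rw [h0, zero_pow hn.ne'] at h
        exact ha h.symm
      -- `f` agrees with `f z₀ + φ ^ n` near `z`, so the derivatives agree
      have hloc : f =ᶠ[𝓝 z] fun w => f z₀ + φ w ^ n :=
        eventually_of_mem (hNopen.mem_nhds hzN) fun w hw => hNf w hw
      have hd : HasDerivAt (fun w => f z₀ + φ w ^ n) (↑n * φ z ^ (n - 1) * deriv φ z) z :=
        ((hNan z hzN).differentiableAt.hasDerivAt.fun_pow n).const_add (f z₀)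
      rw [hloc.deriv_eq, hd.deriv]
      exact mul_ne_zero (mul_ne_zero (Nat.cast_ne_zero.mpr hn.ne') (pow_ne_zero _ hφz))
        (hNder z hzN)

end Summit.SmoothPoincare4.SmoothPoincare4.Theorems.WitnessCharge.PencilIncompleteness
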